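import Mathlib
import Summits.QuantumFields.BalabanUV.Beta.DecouplingExpansion19
import Summits.QuantumFields.BalabanUV.Beta.DecouplingSupportWalks110

/-!
# [Balaban1988RG2Cluster] p. 6 ∕ p. 10: the POLYDISC ANALYTICITY of the decorated terms in the decoupling parameters —
# «𝐇_k(s(Y₀), B′)) is an analytic function of s(Y₀)», «The underintegral expression is analytic in σ(Y) on the polydisc
# |σ(Y)| ≦ e^{κ₁}» — DERIVED in the cell's abstract model for the `s`-weighted walk sums and the term shapes T3∕T5∕T6∕T7:
# the sibling's hypothesis `SepHolNear` DISCHARGED, hence (1.8) = (1.10) for T5 with NO analytic hypothesis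
# (cell topic `Summits/QuantumFields/BalabanUV/Beta`; row-D4 terminal leaf (T4)(b), census §10.12.2 dictionary item (d3))

HONEST FRAMING (cell rule).  Discharging `BetaPertH` makes Bałaban's UV stability UNCONDITIONAL — a real
constructive-QFT result; NOT the continuum limit, NOT the Clay problem.  This module discharges NOTHING of `BetaPertH`.
It removes, in abstract kernel form, the one ANALYTIC hypothesis left in the cell's typing of the decoupling expansion
(1.8) = (1.9) = (1.10) of [II] pp. 3–4: the sibling `DecouplingExpansion19` (p204558) proved (1.8) = (1.10) under
`SepHolNear F σ₀ U` — separate holomorphy of the integrand in each decoupling variable near the closed polydisc —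
stated there as the printed sentences of p. 6 and p. 10.  For the objects the siblings model the sentence is a THEOREM:
the `s`-weighted walk sums of `DecouplingSupport110` (p204556) carry weights `s(Δ₁)⋯s(Δ_m)` that are MULTILINEAR in
the parameters, so every entry of `H(s)` and every `□`-piece of the polynomial term shapes T3∕T5∕T6 of [I] (2.12) is
ENTIRE in each `s(Δ)`; the walk SERIES of `DecouplingSupportWalks110` (p204980) is holomorphic on the open polydisc of
radius `r` under the (1.7)-type majorant `Σ_ω r^{m(ω)}‖H_ω‖ < ∞` (Weierstrass); a localized analytic functional of
such fields (the printed example T7) is holomorphic by the chain rule.  Composed BY NAME with the siblings this gives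
the kernel identity (1.8) = (1.10) for T5 with walk-sum propagators from GEOMETRIC binders only.  NOT summit
progress.  Unit `b2b-balaban-beta-an4-g35` (owner of `BINDER-OWNERS.md` row D4); cell `GAPS.md` C-an4-73.

CITATION HEADER (lean-in-tree rule).  [II] = T. Bałaban, *Renormalization group approach to lattice gauge field
theories. II. Cluster expansions*, Commun. Math. Phys. **116**, 1–22 (1988) [Balaban1988RG2Cluster] (journal page =
PDF page; renders `HOME/b2b-balaban-ref1/pages/1988-cmp116-rg-II-cluster/…-p003-x2.png`, `…-p005-x2.png`,
`…-p006-x2.png`, `…-p010-x2.png`, READ AS IMAGES by this unit).  WHAT IS REPRODUCED — p. 3 [PDF 3], verbatim: *"A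
propagator is represented by the sum (3.107) [13] Σ_ω R₀(X₀)R_{α₁}(X₁)⋯R_{α_n}(X_n), (1.6) … The term corresponding
to a walk ω in (1.6) can be bounded, as (3.108) [13], by O(1)O(M₁^{−1/2})^{|ω|}M₁^{−1/2|ω|}exp(−δ₀d(ω, y, y′)), (1.7)
… for a random walk ω localized in X̃₀⁵ ∪ X̃₁⁵ ∪ ⋯ ∪ X̃_n⁵ we take the {Δ₁, …, Δ_m} of all cubes from σ₀ which
intersect this localization domain, and we multiply the term in (1.6) corresponding to ω by s(Δ₁)⋯s(Δ_m). This way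
the s-dependent propagators H(s), G̃(s), H₀(s) are defined."*; p. 5 [PDF 5], verbatim: *"To estimate a term in the
sum (1.10) we use the Cauchy formula, hence we have to investigate analyticity properties of the functions 𝐄(⋯) with
respect to the variables s(Y₀)."* and, after (1.11): *"Thus the function H(s(Y₀))X is an analytic function of the
variables s(Y₀) on the domain |s(Y₀)| ≦ e^{κ₁}, bounded by B₀e^{16κ₁}|X| in all norms of Theorems 3.1.-3.10 [13]."*;
p. 6 [PDF 6] after (1.20), verbatim: *"𝐇_k(s(Y₀), B′)) is an analytic function of s(Y₀), B, for |s(Y₀)| ≦ e^{κ₁} and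
g_k|B| < ε₁"*; p. 10 [PDF 10] after (1.38), verbatim: *"The underintegral expression is analytic in σ(Y) on the
polydisc |σ(Y)| ≦ e^{κ₁}. The estimates (33), (37), (55), (57), (58) [15] imply the bound"* (1.39).  (v1.0.1: the p. 3
and p. 10 quotations of v1 were paraphrases; replaced by the verbatim spans — docstring-only, declarations unchanged.)

WHAT IS CERTIFIED HERE (kernel, sorry-free; [folklore] one-variable complex analysis, in the vocabulary of the
siblings: sites `Λ` (finite), parameters `τ : Pt d → ℂ`, kernels `(Pt d → ℂ) → Λ → Λ → 𝔸` with entries in a complex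
normed algebra `𝔸`, fields `(Pt d → ℂ) → Λ → M` with values in a normed `𝔸`-module `M` over `ℂ`).
§1 COORDINATE HOLOMORPHY — `InPoly U τ` (all coordinates in `U`), `FieldHol U σ₀ f` ∕ `KernelHol U σ₀ K` (every
   component is `SepHolNear`); calculus: constants, sums, differences, site scalars, **`fieldHol_kapply`** (a
   coordinate-holomorphic kernel applied to a coordinate-holomorphic field — Mathlib's `DifferentiableOn.smul` over the
   normed algebra `𝔸`), **`sepHolNear_pairing`** (a `□`-localized continuous bilinear pairing `Σ_{x∈□} B(f(x), g(x))`),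
   **`sepHolNear_comp`** (an analytic functional of the field after a coordinate-holomorphic field — chain rule).
§2 THE WALK SUMS — `differentiable_weight_update` (the decoupling weight `∏_{Δ∈cubes ω∖R} s(Δ)` is AFFINE in each
   coordinate: `Finset.prod_update_of_mem`), `norm_weight_le` (`|weight| ≤ r^{m(ω)}` on the polydisc of radius `r`),
   **`kernelHol_walkSum`** (finite walk sums are coordinate-holomorphic on EVERY open set — no hypothesis),
   **`kernelHol_walkTsum`** (walk series on the open polydisc of radius `r` under `Σ_ω r^{m(ω)}‖H_ω(x,y)‖ < ∞` —
   Mathlib `Complex.differentiableOn_tsum_of_summable_norm`).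
§3 THE TERM SHAPES — `biAdd B` (a continuous bilinear map read as the siblings' `M →+ M →+ N`),
   **`sepHolNear_T3loc ∕ _T5loc ∕ _T6loc ∕ _T7loc`** from coordinate-holomorphic propagators; ENDs
   **`sepHolNear_T5loc_walkSum`** (hypothesis-free) and **`eq_sum_term19_connected_T5loc_walkSum`**: for the `□`-piece
   of T5 with finite-walk-sum propagators, `F(1 on σ₀) = Σ_{σ⊆σ₀, □̃⁴∪⋃σ connected} term19 ρ F σ` — (1.8) = (1.10) —
   from `1 < ρ` and the GEOMETRIC binders of `DecouplingSupport110.supportedOnRootComp_T5loc` alone; and the series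
   form **`eq_sum_term19_connected_T5loc_walkTsum`** on the polydisc `r > ρ` under the (1.7)-type majorants.

NOT CLAIMED (located, by name).  That Bałaban's complexified `H₁(σ(Y))`, `Δ₁(σ(Y))` ARE such walk sums∕series
(dictionary (d1), definitional: [II] p. 3 + [13] (3.107)); the majorant (1.7) itself and the value `e^{κ₁}` of the
radius (B9's random-walk expansion — GAPS G-B13-01 ∕ G-IF-10, row-D4 terminal leaves (T2)∕(T3)); the analyticity of
the fixed points `D(H(s), ·)`, `𝐀₀(s)` of (1.3)–(1.4) entering Lemma 1's term (the contraction scheme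
`B13Contraction113.differentiableOn_fixedPoint` — composed in the sibling-to-be `DecouplingHolomorphyFixedPoint110`,
not here); joint analyticity in several `s(Δ)` (separate holomorphy is what (1.23) consumes; Osgood∕Hartogs not
formalised); every BOUND; NOT summit progress.  MODEL CONVENTIONS: as in the siblings; "analytic" = `DifferentiableOn ℂ`
in one complex coordinate at a time at base vectors with all coordinates in the open set `U` (= the sibling's
`SepHolNear`); kernel entries in a normed `ℂ`-algebra `𝔸` acting boundedly on the normed field-value space `M`
(`IsBoundedSMul 𝔸 M`, `IsScalarTower ℂ 𝔸 M` — matrices on vectors, or `𝔸 = ℂ`).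
-/

namespace Summit.QuantumFields.BalabanUV.Beta.DecouplingHolomorphy110

open Literature.MathematicalPhysics.QuantumFieldTheory.Balaban1983to89.B14DomainGeom (Pt)
open Literature.MathematicalPhysics.QuantumFieldTheory.Balaban1983to89.B13Factor210 (WallConnected)
open Summit.QuantumFields.BalabanUV.Beta.DecouplingResummation110 (rootComp SupportedOnRootComp term19)
open Summit.QuantumFields.BalabanUV.Beta.DecouplingExpansion19 (SepHolNear setOne eq_sum_term19_connected)
open Summit.QuantumFields.BalabanUV.Beta.DecouplingSupport110 (BlockLocal kapply T3loc T5loc T6loc weight walkSum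
  supportedOnRootComp_T5loc)
open Summit.QuantumFields.BalabanUV.Beta.DecouplingSupportWalks110 (walkTsum T7loc blockLocal_walkTsum
  supportedOnRootComp_T5loc_of_blockLocal)
open Summit.QuantumFields.BalabanUV.Beta.DecouplingSupportFixedPoint110 (LocalizedIn)
open Complex Metric Set

noncomputable section

variable {d : ℕ} {Λ : Type*}

/-! ## §1 Coordinate holomorphy on the polydomain `U^{Pt d}`: the calculus -/

section Calculus

variable {X : Type*} [NormedAddCommGroup X] [NormedSpace ℂ X]

/-- A parameter vector with ALL coordinates in `U` (a point of the polydomain `U^{Pt d}`; [II] p. 10 *"the polydisc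
|σ(Y)| ≦ e^{κ₁}"*). [folklore] -/
def InPoly (U : Set ℂ) (τ : Pt d → ℂ) : Prop := ∀ j, τ j ∈ U

omit [NormedAddCommGroup X] [NormedSpace ℂ X] in
/-- Moving one coordinate inside `U` keeps a vector in the polydomain. [folklore] -/
theorem InPoly.update {U : Set ℂ} {τ : Pt d → ℂ} (hτ : InPoly U τ) (i : Pt d) {z : ℂ} (hz : z ∈ U) :
    InPoly U (Function.update τ i z) := fun j => by
  by_cases h : j = i
  · subst h; simpa using hz
  · rw [Function.update_of_ne h]; exact hτ j

/-- A decorated FIELD is coordinate-holomorphic: every site value is `SepHolNear`. [folklore] -/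
def FieldHol (U : Set ℂ) (σ₀ : Finset (Pt d)) (f : (Pt d → ℂ) → Λ → X) : Prop :=
  ∀ x, SepHolNear (fun τ => f τ x) σ₀ U

/-- A decorated KERNEL is coordinate-holomorphic: every entry is `SepHolNear` ([II] p. 5: *"the function H(s(Y₀))X is
an analytic function of the variables s(Y₀)"*). [cite: Balaban1988RG2Cluster, p.5 after (1.11)] -/
def KernelHol (U : Set ℂ) (σ₀ : Finset (Pt d)) (K : (Pt d → ℂ) → Λ → Λ → X) : Prop :=
  ∀ x y, SepHolNear (fun τ => K τ x y) σ₀ U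

/-- Constants are separately holomorphic. [folklore] -/
theorem sepHolNear_const (U : Set ℂ) (σ₀ : Finset (Pt d)) (c : X) : SepHolNear (fun _ : Pt d → ℂ => c) σ₀ U :=
  fun _ _ _ _ => differentiableOn_const c

/-- Undecorated fields (`g_kCB`, `J`, `B′`: no parameter) are coordinate-holomorphic. [folklore] -/
theorem fieldHol_const (U : Set ℂ) (σ₀ : Finset (Pt d)) (v : Λ → X) : FieldHol U σ₀ (fun _ : Pt d → ℂ => v) :=
  fun x => sepHolNear_const U σ₀ (v x)

/-- Sums of separately holomorphic functionals. [folklore] -/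
theorem SepHolNear.add {U : Set ℂ} {σ₀ : Finset (Pt d)} {F G : (Pt d → ℂ) → X} (hF : SepHolNear F σ₀ U)
    (hG : SepHolNear G σ₀ U) : SepHolNear (fun τ => F τ + G τ) σ₀ U :=
  fun i hi τ hτ => (hF i hi τ hτ).add (hG i hi τ hτ)

/-- Differences of separately holomorphic functionals. [folklore] -/
theorem SepHolNear.sub {U : Set ℂ} {σ₀ : Finset (Pt d)} {F G : (Pt d → ℂ) → X} (hF : SepHolNear F σ₀ U)
    (hG : SepHolNear G σ₀ U) : SepHolNear (fun τ => F τ - G τ) σ₀ U :=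
  fun i hi τ hτ => (hF i hi τ hτ).sub (hG i hi τ hτ)

/-- Negation. [folklore] -/
theorem SepHolNear.neg {U : Set ℂ} {σ₀ : Finset (Pt d)} {F : (Pt d → ℂ) → X} (hF : SepHolNear F σ₀ U) :
    SepHolNear (fun τ => -F τ) σ₀ U :=
  fun i hi τ hτ => (hF i hi τ hτ).neg

/-- Finite sums of separately holomorphic functionals. [folklore] -/
theorem sepHolNear_sum {ι : Type*} {U : Set ℂ} {σ₀ : Finset (Pt d)} (s : Finset ι) {F : ι → (Pt d → ℂ) → X}
    (hF : ∀ k ∈ s, SepHolNear (F k) σ₀ U) : SepHolNear (fun τ => ∑ k ∈ s, F k τ) σ₀ U :=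
  fun i hi τ hτ => DifferentiableOn.fun_sum fun k hk => hF k hk i hi τ hτ

/-- Sums ∕ differences ∕ site-scalar multiples of coordinate-holomorphic fields. [folklore] -/
theorem FieldHol.add {U : Set ℂ} {σ₀ : Finset (Pt d)} {f g : (Pt d → ℂ) → Λ → X} (hf : FieldHol U σ₀ f)
    (hg : FieldHol U σ₀ g) : FieldHol U σ₀ (fun τ x => f τ x + g τ x) :=
  fun x => SepHolNear.add (hf x) (hg x)

/-- Differences of coordinate-holomorphic fields. [folklore] -/
theorem FieldHol.sub {U : Set ℂ} {σ₀ : Finset (Pt d)} {f g : (Pt d → ℂ) → Λ → X} (hf : FieldHol U σ₀ f)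
    (hg : FieldHol U σ₀ g) : FieldHol U σ₀ (fun τ x => f τ x - g τ x) :=
  fun x => SepHolNear.sub (hf x) (hg x)

/-- Multiplying by SITE SCALARS (`tζ̃_□ + t_□ζ_□` of (1.1)) keeps a field coordinate-holomorphic. [folklore] -/
theorem FieldHol.smul_site {R : Type*} [Semiring R] [Module R X] [SMulCommClass ℂ R X] [ContinuousConstSMul R X]
    {U : Set ℂ} {σ₀ : Finset (Pt d)} (ζ : Λ → R) {f : (Pt d → ℂ) → Λ → X} (hf : FieldHol U σ₀ f) :
    FieldHol U σ₀ (fun τ x => ζ x • f τ x) :=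
  fun x i hi τ hτ => (hf x i hi τ hτ).const_smul (ζ x)

variable [Fintype Λ] {𝔸 : Type*} [NormedRing 𝔸] [NormedAlgebra ℂ 𝔸] {M : Type*} [NormedAddCommGroup M]
  [NormedSpace ℂ M] [Module 𝔸 M] [IsBoundedSMul 𝔸 M] [IsScalarTower ℂ 𝔸 M]
  {N : Type*} [NormedAddCommGroup N] [NormedSpace ℂ N]

/-- **APPLY**: a coordinate-holomorphic kernel applied to a coordinate-holomorphic field is a coordinate-holomorphic
field (`(K·v)(x) = Σ_y K(x,y) • v(y)`; product rule over the normed algebra `𝔸`). [folklore] -/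
theorem fieldHol_kapply {U : Set ℂ} {σ₀ : Finset (Pt d)} {K : (Pt d → ℂ) → Λ → Λ → 𝔸} {f : (Pt d → ℂ) → Λ → M}
    (hK : KernelHol U σ₀ K) (hf : FieldHol U σ₀ f) : FieldHol U σ₀ (fun τ => kapply (K τ) (f τ)) := by
  intro x i hi τ hτ
  unfold kapply
  exact DifferentiableOn.fun_sum fun y _ => (hK x y i hi τ hτ).smul (hf y i hi τ hτ)

/-- A continuous bilinear map read as the siblings' biadditive pairing `M →+ M →+ N`. [folklore] -/
def biAdd (B : M →L[ℂ] M →L[ℂ] N) : M →+ M →+ N where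
  toFun m := ((B m : M →L[ℂ] N) : M →ₗ[ℂ] N).toAddMonoidHom
  map_zero' := by ext m'; simp
  map_add' m₁ m₂ := by ext m'; simp

omit [Fintype Λ] [NormedRing 𝔸] [NormedAlgebra ℂ 𝔸] [Module 𝔸 M] [IsBoundedSMul 𝔸 M] [IsScalarTower ℂ 𝔸 M] in
/-- `biAdd B m m′ = B m m′`. [folklore] -/
@[simp] theorem biAdd_apply (B : M →L[ℂ] M →L[ℂ] N) (m m' : M) : biAdd B m m' = B m m' := rfl

omit [Fintype Λ] [NormedRing 𝔸] [NormedAlgebra ℂ 𝔸] [Module 𝔸 M] [IsBoundedSMul 𝔸 M] [IsScalarTower ℂ 𝔸 M] in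
/-- **LOCALIZED PAIRING**: `τ ↦ Σ_{x∈□} B(f(τ)(x), g(τ)(x))` is separately holomorphic for coordinate-holomorphic
fields and a continuous bilinear `B` (the `□`-piece `⟨·, 1_□ ·⟩` of an inner product). [folklore] -/
theorem sepHolNear_pairing {U : Set ℂ} {σ₀ : Finset (Pt d)} (B : M →L[ℂ] M →L[ℂ] N) (box : Finset Λ)
    {f g : (Pt d → ℂ) → Λ → M} (hf : FieldHol U σ₀ f) (hg : FieldHol U σ₀ g) :
    SepHolNear (fun τ => ∑ x ∈ box, B (f τ x) (g τ x)) σ₀ U :=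
  sepHolNear_sum box fun x _ i hi τ hτ =>
    ((B : M →L[ℂ] M →L[ℂ] N).differentiable.comp_differentiableOn (hf x i hi τ hτ)).clm_apply (hg x i hi τ hτ)

omit [NormedRing 𝔸] [NormedAlgebra ℂ 𝔸] [Module 𝔸 M] [IsBoundedSMul 𝔸 M] [IsScalarTower ℂ 𝔸 M] in
/-- **CHAIN RULE**: an analytic functional `Ψ` of the field (holomorphic on an open region `S` of the finite-dimensional
field space containing the fields in question — [II] p. 2 *"E(X, 𝐔, 𝐉, 𝐀) analytic … in 𝐀"*) after a coordinate-
holomorphic field is separately holomorphic. [folklore] -/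
theorem sepHolNear_comp {U : Set ℂ} {σ₀ : Finset (Pt d)} {Ψ : (Λ → M) → N} {S : Set (Λ → M)}
    (hΨ : DifferentiableOn ℂ Ψ S) {f : (Pt d → ℂ) → Λ → M} (hf : FieldHol U σ₀ f)
    (hS : ∀ τ, InPoly U τ → f τ ∈ S) : SepHolNear (fun τ => Ψ (f τ)) σ₀ U :=
  fun i hi τ hτ => hΨ.comp (differentiableOn_pi.2 fun x => hf x i hi τ hτ) fun _ hz => hS _ (InPoly.update hτ i hz)

end Calculus

/-! ## §2 The `s`-weighted walk sums and series are coordinate-holomorphic -/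

section Walks

variable {Ω : Type*}

/-- THE DECOUPLING WEIGHT IS AFFINE IN EACH COORDINATE: `z ↦ ∏_{Δ∈cubes ω∖R} s(Δ)` with `s(Δ′) = z` is `z·c` or
constant — entire. [folklore] -/
theorem differentiable_weight_update (R : Finset (Pt d)) (cubes : Ω → Finset (Pt d)) (o : Ω) (τ : Pt d → ℂ)
    (i : Pt d) : Differentiable ℂ (fun z => weight R cubes o (Function.update τ i z)) := by
  unfold weight
  by_cases hi : i ∈ cubes o \ R
  · simp_rw [Finset.prod_update_of_mem hi]
    exact differentiable_id.mul (differentiable_const _)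
  · simp_rw [Finset.prod_update_of_notMem hi]
    exact differentiable_const _

/-- ON THE POLYDISC of radius `r` the weight of a walk meeting `m(ω)` parameter cubes is bounded by `r^{m(ω)}` (the
factor `e^{mκ₁}` of (1.11) for `r = e^{κ₁}`). [cite: Balaban1988RG2Cluster, (1.11) p.5] -/
theorem norm_weight_le {r : ℝ} (R : Finset (Pt d)) (cubes : Ω → Finset (Pt d)) (o : Ω) {τ : Pt d → ℂ}
    (hτ : ∀ j, ‖τ j‖ ≤ r) : ‖weight R cubes o τ‖ ≤ r ^ (cubes o \ R).card := by
  unfold weight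
  rw [norm_prod, ← Finset.prod_const]
  exact Finset.prod_le_prod (fun _ _ => norm_nonneg _) fun Δ _ => hτ Δ

variable [Fintype Λ] {𝔸 : Type*} [NormedRing 𝔸] [NormedAlgebra ℂ 𝔸]

omit [Fintype Λ] in
/-- **FINITE WALK SUMS ARE COORDINATE-HOLOMORPHIC ON EVERY OPEN SET** — each entry `Σ_ω s(Δ₁)⋯s(Δ_m)·H_ω(x,y)` is a
polynomial in the parameters ([II] p. 3 definition of the decoration); no hypothesis. [cite: Balaban1988RG2Cluster, (1.6)–(1.8) p.3] -/
theorem kernelHol_walkSum (U : Set ℂ) (σ₀ : Finset (Pt d)) (R : Finset (Pt d)) (walks : Finset Ω)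
    (cubes : Ω → Finset (Pt d)) (ker : Ω → Λ → Λ → 𝔸) : KernelHol U σ₀ (walkSum R walks cubes ker) := by
  intro x y i _ τ _
  unfold walkSum
  exact DifferentiableOn.fun_sum fun o _ =>
    ((differentiable_weight_update R cubes o τ i).differentiableOn).smul_const (ker o x y)

omit [Fintype Λ] in
/-- **WALK SERIES ARE COORDINATE-HOLOMORPHIC ON THE OPEN POLYDISC** of radius `r` under the (1.7)-type majorant
`Σ_ω r^{m(ω)}‖H_ω(x,y)‖ < ∞` (Weierstrass M-test + locally uniform limits of holomorphic functions, Mathlib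
`Complex.differentiableOn_tsum_of_summable_norm`) — [II] p. 5: *"Thus the function H(s(Y₀))X is an analytic function
of the variables s(Y₀) on the domain |s(Y₀)| ≦ e^{κ₁}"*. [cite: Balaban1988RG2Cluster, p.5 after (1.11)] -/
theorem kernelHol_walkTsum [CompleteSpace 𝔸] {r : ℝ} (σ₀ : Finset (Pt d)) (R : Finset (Pt d))
    (cubes : Ω → Finset (Pt d)) {ker : Ω → Λ → Λ → 𝔸}
    (hsum : ∀ x y, Summable fun o => r ^ (cubes o \ R).card * ‖ker o x y‖) :
    KernelHol (ball (0 : ℂ) r) σ₀ (walkTsum R cubes ker) := by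
  intro x y i _ τ hτ
  unfold walkTsum
  refine Complex.differentiableOn_tsum_of_summable_norm (hsum x y)
    (fun o => ((differentiable_weight_update R cubes o τ i).differentiableOn).smul_const (ker o x y))
    isOpen_ball fun o z hz => ?_
  refine (norm_smul_le _ _).trans (mul_le_mul_of_nonneg_right ?_ (norm_nonneg _))
  refine norm_weight_le R cubes o fun j => ?_
  by_cases h : j = i
  · subst h; simpa using (mem_ball_zero_iff.1 hz).le
  · rw [Function.update_of_ne h]; exact (mem_ball_zero_iff.1 (hτ j)).le

end Walks

/-! ## §3 The term shapes T3, T5, T6 of [I] (2.12) and the printed example T7; the ENDs -/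

section Terms

variable [Fintype Λ] {𝔸 : Type*} [NormedRing 𝔸] [NormedAlgebra ℂ 𝔸] {M : Type*} [NormedAddCommGroup M]
  [NormedSpace ℂ M] [Module 𝔸 M] [IsBoundedSMul 𝔸 M] [IsScalarTower ℂ 𝔸 M]
  {N : Type*} [NormedAddCommGroup N] [NormedSpace ℂ N]

/-- **T5's `□`-piece is separately holomorphic** for coordinate-holomorphic `H₁(s)`, `Δ₁(s)`
(`Σ_{x∈□} B((H₁v)(x), (Δ₁H₁w)(x))`). [cite: Balaban1987RG1, (2.12) p.268] -/
theorem sepHolNear_T5loc {U : Set ℂ} {σ₀ : Finset (Pt d)} (B : M →L[ℂ] M →L[ℂ] N) (box : Finset Λ)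
    {H₁ Δ₁ : (Pt d → ℂ) → Λ → Λ → 𝔸} (hH : KernelHol U σ₀ H₁) (hΔ : KernelHol U σ₀ Δ₁) (v w : Λ → M) :
    SepHolNear (T5loc (biAdd B) box H₁ Δ₁ v w) σ₀ U := by
  unfold T5loc
  simpa only [biAdd_apply] using sepHolNear_pairing B box (hf := fieldHol_kapply hH (fieldHol_const U σ₀ v))
    (hg := fieldHol_kapply hΔ (fieldHol_kapply hH (fieldHol_const U σ₀ w)))

/-- **T3's `□`-piece is separately holomorphic** (`Σ_{x∈□} B((H₁u)(x), J(x))`, `J` undecorated).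
[cite: Balaban1987RG1, (2.12) p.268] -/
theorem sepHolNear_T3loc {U : Set ℂ} {σ₀ : Finset (Pt d)} (B : M →L[ℂ] M →L[ℂ] N) (box : Finset Λ)
    {H₁ : (Pt d → ℂ) → Λ → Λ → 𝔸} (hH : KernelHol U σ₀ H₁) (u J : Λ → M) :
    SepHolNear (T3loc (biAdd B) box H₁ u J) σ₀ U := by
  unfold T3loc
  simpa only [biAdd_apply] using sepHolNear_pairing B box (hf := fieldHol_kapply hH (fieldHol_const U σ₀ u))
    (hg := fieldHol_const U σ₀ J)

/-- **T6's `□`-piece is separately holomorphic** (T5's shape with both fields `w`). [cite: Balaban1987RG1, (2.12) p.268] -/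
theorem sepHolNear_T6loc {U : Set ℂ} {σ₀ : Finset (Pt d)} (B : M →L[ℂ] M →L[ℂ] N) (box : Finset Λ)
    {H₁ Δ₁ : (Pt d → ℂ) → Λ → Λ → 𝔸} (hH : KernelHol U σ₀ H₁) (hΔ : KernelHol U σ₀ Δ₁) (w : Λ → M) :
    SepHolNear (T6loc (biAdd B) box H₁ Δ₁ w) σ₀ U :=
  sepHolNear_T5loc B box hH hΔ w w

/-- **T7's `□`-piece is separately holomorphic**: the localized functional `V_□` holomorphic on an open region `S` of
field space containing the fields `H₁(s)B′` ([II] p. 10: *"V_□(σ(Y), H₁(σ(Y))B′)"* analytic in `σ(Y)`).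
[cite: Balaban1988RG2Cluster, (1.38) p.10] -/
theorem sepHolNear_T7loc {U : Set ℂ} {σ₀ : Finset (Pt d)} {Vbox : (Λ → M) → N} {S : Set (Λ → M)}
    (hV : DifferentiableOn ℂ Vbox S) {H₁ : (Pt d → ℂ) → Λ → Λ → 𝔸} (hH : KernelHol U σ₀ H₁) (Bp : Λ → M)
    (hS : ∀ τ, InPoly U τ → kapply (H₁ τ) Bp ∈ S) : SepHolNear (T7loc Vbox H₁ Bp) σ₀ U :=
  sepHolNear_comp hV (fieldHol_kapply hH (fieldHol_const U σ₀ Bp)) hS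

variable {Ω₁ Ω₂ : Type*}

/-- **END (hypothesis-free): T5's `□`-piece with FINITE-WALK-SUM propagators is separately holomorphic on every open
set** — the sibling's analytic hypothesis `SepHolNear` DISCHARGED for these objects. [cite: Balaban1988RG2Cluster, p.10 after (1.38)] -/
theorem sepHolNear_T5loc_walkSum (U : Set ℂ) (σ₀ : Finset (Pt d)) (B : M →L[ℂ] M →L[ℂ] N) (box : Finset Λ)
    (R : Finset (Pt d)) (walks₁ : Finset Ω₁) (cubes₁ : Ω₁ → Finset (Pt d)) (ker₁ : Ω₁ → Λ → Λ → 𝔸)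
    (walks₂ : Finset Ω₂) (cubes₂ : Ω₂ → Finset (Pt d)) (ker₂ : Ω₂ → Λ → Λ → 𝔸) (v w : Λ → M) :
    SepHolNear (T5loc (biAdd B) box (walkSum R walks₁ cubes₁ ker₁) (walkSum R walks₂ cubes₂ ker₂) v w) σ₀ U :=
  sepHolNear_T5loc B box (kernelHol_walkSum U σ₀ R walks₁ cubes₁ ker₁) (kernelHol_walkSum U σ₀ R walks₂ cubes₂ ker₂)
    v w

open Classical in
/-- **(1.8) = (1.10) FOR T5 WITH FINITE-WALK-SUM PROPAGATORS, FROM GEOMETRIC BINDERS ONLY** (kernel END; composition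
BY NAME of `DecouplingExpansion19.eq_sum_term19_connected` with the sibling's support theorem
`DecouplingSupport110.supportedOnRootComp_T5loc` and this module's holomorphy): for `□ ⊆ □̃⁴` (`R` wall-connected
∋ `a₀`), wall-connected walk cube families and walk kernels supported on their cubes, the value of T5's `□`-piece at
`s = 1` on `σ₀` equals the sum of its `σ`-terms (1.23) over the CONNECTED domains `□̃⁴ ∪ ⋃σ` — NO analytic and NO
support hypothesis remains. [cite: Balaban1988RG2Cluster, (1.8)–(1.10) pp.3–4] -/
theorem eq_sum_term19_connected_T5loc_walkSum [CompleteSpace N] {ρ : ℝ} (hρ : 1 < ρ) (cube : Λ → Pt d)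
    (B : M →L[ℂ] M →L[ℂ] N) {box : Finset Λ} {R σ₀ : Finset (Pt d)} {a₀ : Pt d}
    (hR : WallConnected (↑R : Set (Pt d))) (ha₀ : a₀ ∈ R) (hbox : ∀ x ∈ box, cube x ∈ R)
    {walks₁ : Finset Ω₁} {cubes₁ : Ω₁ → Finset (Pt d)} {ker₁ : Ω₁ → Λ → Λ → 𝔸}
    (hconn₁ : ∀ o ∈ walks₁, WallConnected (↑(cubes₁ o) : Set (Pt d)))
    (hsupp₁ : ∀ o ∈ walks₁, ∀ x y, ker₁ o x y ≠ 0 → cube x ∈ cubes₁ o ∧ cube y ∈ cubes₁ o)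
    {walks₂ : Finset Ω₂} {cubes₂ : Ω₂ → Finset (Pt d)} {ker₂ : Ω₂ → Λ → Λ → 𝔸}
    (hconn₂ : ∀ o ∈ walks₂, WallConnected (↑(cubes₂ o) : Set (Pt d)))
    (hsupp₂ : ∀ o ∈ walks₂, ∀ x y, ker₂ o x y ≠ 0 → cube x ∈ cubes₂ o ∧ cube y ∈ cubes₂ o) (v w : Λ → M) :
    T5loc (biAdd B) box (walkSum R walks₁ cubes₁ ker₁) (walkSum R walks₂ cubes₂ ker₂) v w (setOne σ₀ 0)
      = ∑ σ ∈ σ₀.powerset with WallConnected (↑(R ∪ σ) : Set (Pt d)),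
          term19 ρ (T5loc (biAdd B) box (walkSum R walks₁ cubes₁ ker₁) (walkSum R walks₂ cubes₂ ker₂) v w) σ :=
  eq_sum_term19_connected hρ isOpen_univ (subset_univ _) hR ha₀
    (sepHolNear_T5loc_walkSum univ σ₀ B box R walks₁ cubes₁ ker₁ walks₂ cubes₂ ker₂ v w)
    (supportedOnRootComp_T5loc cube (biAdd B) hR ha₀ hbox hconn₁ hsupp₁ hconn₂ hsupp₂ v w)

open Classical in
/-- **(1.8) = (1.10) FOR T5 WITH WALK-SERIES PROPAGATORS ON THE POLYDISC** `|s(Δ)| < r`, `r > ρ > 1`, under the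
(1.7)-type majorants of the two series (and the geometric binders of `DecouplingSupportWalks110.blockLocal_walkTsum`):
the analytic hypothesis is DISCHARGED by `kernelHol_walkTsum`, the support by the sibling. [cite: Balaban1988RG2Cluster, (1.8)–(1.10) pp.3–4] -/
theorem eq_sum_term19_connected_T5loc_walkTsum [CompleteSpace 𝔸] [CompleteSpace N] {ρ r : ℝ} (hρ : 1 < ρ)
    (hr : ρ < r) (cube : Λ → Pt d) (B : M →L[ℂ] M →L[ℂ] N) {box : Finset Λ} {R σ₀ : Finset (Pt d)} {a₀ : Pt d}
    (hR : WallConnected (↑R : Set (Pt d))) (ha₀ : a₀ ∈ R) (hbox : ∀ x ∈ box, cube x ∈ R)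
    {cubes₁ : Ω₁ → Finset (Pt d)} {ker₁ : Ω₁ → Λ → Λ → 𝔸}
    (hconn₁ : ∀ o, WallConnected (↑(cubes₁ o) : Set (Pt d)))
    (hsupp₁ : ∀ o x y, ker₁ o x y ≠ 0 → cube x ∈ cubes₁ o ∧ cube y ∈ cubes₁ o)
    (hsum₁ : ∀ x y, Summable fun o => r ^ (cubes₁ o \ R).card * ‖ker₁ o x y‖)
    {cubes₂ : Ω₂ → Finset (Pt d)} {ker₂ : Ω₂ → Λ → Λ → 𝔸}
    (hconn₂ : ∀ o, WallConnected (↑(cubes₂ o) : Set (Pt d)))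
    (hsupp₂ : ∀ o x y, ker₂ o x y ≠ 0 → cube x ∈ cubes₂ o ∧ cube y ∈ cubes₂ o)
    (hsum₂ : ∀ x y, Summable fun o => r ^ (cubes₂ o \ R).card * ‖ker₂ o x y‖) (v w : Λ → M) :
    T5loc (biAdd B) box (walkTsum R cubes₁ ker₁) (walkTsum R cubes₂ ker₂) v w (setOne σ₀ 0)
      = ∑ σ ∈ σ₀.powerset with WallConnected (↑(R ∪ σ) : Set (Pt d)),
          term19 ρ (T5loc (biAdd B) box (walkTsum R cubes₁ ker₁) (walkTsum R cubes₂ ker₂) v w) σ :=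
  eq_sum_term19_connected hρ isOpen_ball (closedBall_subset_ball hr) hR ha₀
    (sepHolNear_T5loc B box (kernelHol_walkTsum σ₀ R cubes₁ hsum₁) (kernelHol_walkTsum σ₀ R cubes₂ hsum₂) v w)
    (supportedOnRootComp_T5loc_of_blockLocal cube (biAdd B) hR ha₀ hbox
      (fun σ _ => blockLocal_walkTsum cube hconn₁ hsupp₁ σ) (fun σ _ => blockLocal_walkTsum cube hconn₂ hsupp₂ σ) v w)

end Terms

end

end Summit.QuantumFields.BalabanUV.Beta.DecouplingHolomorphy110
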